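import Literature.Analysis.FluidPDE.NSCriticalClosureBesovProofs
import Literature.Analysis.FunctionSpaces.BesovLittlewoodPaleyApproximation
import HarnessLib

/-!
# The high-frequency tail in `L^p`: `‖u - Ṡ_N u‖_{L^p} ≲ 2^{-N} ‖∇u‖_{L^p}`

Analysis/FluidPDE proof file (theorems only: no definition, no named fact). The second half of the
interpolation inequality of W. Wang, Z. Zhang, *Blow-up of critical norms for the 3-D Navier–Stokes
equations*, Sci. China Math. 60 (2017) = arXiv:1510.02589, **Lemma 3.2** ("while for the high
frequency, `‖u^N‖_{L²} ≤ C 2^{-N} ‖u‖_{Ḣ¹}`"), at the level of tempered distributions and for every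
`1 ≤ p ≤ ∞`:

* `eLpNormDistrib_sub_lowFreqCutoff_le_sum_lineDeriv` — for `u ∈ 𝓢'(E, F)` and an orthonormal
  basis `b` of `E`,
  `‖u - Ṡ_N u‖_{L^p} ≤ K · 2^{-N} · ∑_i ‖∂_{b_i} u‖_{L^p}` (in `[0, ∞]`), with `K` depending only on
  `p`, `E` (the blocks `j ≥ N` of `u - Ṡ_N u` are at most `(1 + M₀)` times those of `u`, the others
  vanish — `FunctionSpaces.lpBlockWeight_sub_lowFreqCutoff_le`; each block obeys the **reverse
  Bernstein inequality** `‖Δ̇_j u‖_{L^p} ≤ C 2^{-j} ∑_i ‖Δ̇_j ∂_{b_i} u‖_{L^p}`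
  (`exists_eLpNormDistrib_lpBlock_le_sum_lineDeriv`, BCD Lemma 2.1 / Danchin 2018 Prop. 2.1) and
  the blocks are uniformly bounded on `L^p`; `ℓ¹`-summation of the blocks of the (always realised)
  tail, `FunctionSpaces.eLpNormDistrib_le_tsum_lpBlock`, and a geometric series).

Together with the low-frequency bound `FunctionSpaces.eLpNormDistrib_lowFreqCutoff_le_of_neg`
(`‖Ṡ_N u‖_{L^p} ≲ 2^{-(N+1)s} ‖u‖_{Ḃ^s_{p,∞}}`, `s < 0`) this is the frequency splitting behind
Lemma 3.2, which feeds the far-field step of §4 Step 1 of that paper (the line along which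
`Literature.Analysis.FluidPDE.hasSmoothExtensionPast_of_eHomBesovNorm_bounded` is being discharged,
`NSCriticalClosureBesovESS.lean`).

## References

* W. Wang, Z. Zhang, Sci. China Math. 60 (2017) 637–650 = arXiv:1510.02589, Lemma 3.2.
  [WangZhang2016]
* H. Bahouri, J.-Y. Chemin, R. Danchin, *Fourier Analysis and Nonlinear PDE* (2011), Lemma 2.1.
  [BahouriCheminDanchin2011]
* R. Danchin, *Fourier analysis methods for the compressible Navier–Stokes equations* (2018),
  Prop. 2.1. [Danchin2018FourierCNS]
-/

noncomputable section

open MeasureTheory TemperedDistribution Filter Set Function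
open _root_.Topology
open scoped SchwartzMap ENNReal NNReal LineDeriv

namespace Literature.Analysis.FluidPDE

variable {E : Type*} [NormedAddCommGroup E] [InnerProductSpace ℝ E] [FiniteDimensional ℝ E]
  [MeasurableSpace E] [BorelSpace E] {F : Type*} [NormedAddCommGroup F] [NormedSpace ℂ F]
  [CompleteSpace F]

/-- `2^{-j} = 2^{-N} (1/2)^{j - N}` for `N ≤ j`, through `ℝ≥0∞` real powers. [folklore] -/
theorem two_rpow_neg_eq_mul_half_pow {N j : ℤ} (h : N ≤ j) :
    (2 : ℝ≥0∞) ^ (-(j : ℝ)) = (2 : ℝ≥0∞) ^ (-(N : ℝ)) * (2⁻¹ : ℝ≥0∞) ^ (j - N).natAbs := by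
  have hnat : (((j - N).natAbs : ℕ) : ℝ) = (j : ℝ) - N := by
    have h1 : ((j - N).natAbs : ℤ) = j - N := Int.natAbs_of_nonneg (by omega)
    have h2 : (((j - N).natAbs : ℕ) : ℝ) = (((j - N).natAbs : ℤ) : ℝ) := (Int.cast_natCast _).symm
    rw [h2, h1]
    push_cast
    ring
  rw [← ENNReal.rpow_natCast, hnat, ENNReal.inv_rpow, ← ENNReal.rpow_neg,
    ← ENNReal.rpow_add _ _ two_ne_zero ENNReal.ofNat_ne_top]
  congr 1
  ring

/-- **The high-frequency tail is controlled by the derivatives** (Wang–Zhang 2017, Lemma 3.2,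
high-frequency half, for every `1 ≤ p ≤ ∞`): there is `K` (depending on `p`, `E` and the
orthonormal basis `b`) such that for every tempered distribution `u` and every `N ∈ ℤ`,
`‖u - Ṡ_N u‖_{L^p} ≤ K 2^{-N} ∑_i ‖∂_{b_i} u‖_{L^p}` in `[0, ∞]`. [cite: WangZhang2016, Lemma 3.2] -/
theorem exists_eLpNormDistrib_sub_lowFreqCutoff_le_sum_lineDeriv (p : ℝ≥0∞) [Fact (1 ≤ p)]
    {ι : Type*} [Fintype ι] (b : OrthonormalBasis ι ℝ E) :
    ∃ K : ℝ≥0∞, K ≠ ⊤ ∧ ∀ (N : ℤ) (u : 𝓢'(E, F)),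
      FunctionSpaces.eLpNormDistrib p (u - FunctionSpaces.lowFreqCutoff N u) ≤
        K * (2 : ℝ≥0∞) ^ (-(N : ℝ)) *
          ∑ i, FunctionSpaces.eLpNormDistrib p (∂_{b i} u) := by
  classical
  obtain ⟨C, hC⟩ := exists_eLpNormDistrib_lpBlock_le_sum_lineDeriv (E := E) (F := F) p b
  set M₀ : ℝ≥0∞ := FunctionSpaces.lowFreqOpNormBound E with hM₀
  have hM₀top : M₀ ≠ ⊤ := FunctionSpaces.lowFreqOpNormBound_lt_top.ne
  -- the constant: `(1 + M₀) · C · 2M₀ · 4`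
  refine ⟨(1 + M₀) * C * (2 * M₀) * 4, ?_, fun N u => ?_⟩
  · exact ENNReal.mul_ne_top (ENNReal.mul_ne_top (ENNReal.mul_ne_top
      (ENNReal.add_ne_top.2 ⟨ENNReal.one_ne_top, hM₀top⟩) ENNReal.coe_ne_top)
      (ENNReal.mul_ne_top (by simp) hM₀top)) (by simp)
  set v : 𝓢'(E, F) := u - FunctionSpaces.lowFreqCutoff N u with hv
  set D : ℝ≥0∞ := ∑ i, FunctionSpaces.eLpNormDistrib p (∂_{b i} u) with hD
  -- blockwise: `‖Δ̇_j v‖ ≤ (1 + M₀) ‖Δ̇_j u‖ ≤ (1 + M₀) C 2^{-j} ∑_i ‖Δ̇_j ∂_i u‖ ≤ (1 + M₀) C 2^{-j} 2M₀ D`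
  -- for `j ≥ N`, and `Δ̇_j v = 0` for `j < N`
  have hterm : ∀ j : ℤ, FunctionSpaces.eLpNormDistrib p (FunctionSpaces.lpBlock j v) ≤
      ((1 + M₀) * C * (2 * M₀) * (2 : ℝ≥0∞) ^ (-(N : ℝ)) * D) * (2⁻¹ : ℝ≥0∞) ^ (j - N).natAbs := by
    intro j
    by_cases hj : N ≤ j
    · have h1 : FunctionSpaces.eLpNormDistrib p (FunctionSpaces.lpBlock j v) ≤
          (1 + M₀) * FunctionSpaces.eLpNormDistrib p (FunctionSpaces.lpBlock j u) := by
        have h := FunctionSpaces.lpBlockWeight_sub_lowFreqCutoff_le 0 p N u j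
        simp only [FunctionSpaces.lpBlockWeight, mul_zero, ENNReal.rpow_zero, one_mul, if_pos hj]
          at h
        simpa only [hv, hM₀] using h
      have h2 := hC j u
      have h3 : ∀ i, FunctionSpaces.eLpNormDistrib p (FunctionSpaces.lpBlock j (∂_{b i} u)) ≤
          2 * M₀ * FunctionSpaces.eLpNormDistrib p (∂_{b i} u) := fun i =>
        FunctionSpaces.eLpNormDistrib_lpBlock_le_two_mul j _
      have h4 : ∑ i, FunctionSpaces.eLpNormDistrib p (FunctionSpaces.lpBlock j (∂_{b i} u)) ≤
          2 * M₀ * D := by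
        rw [hD, Finset.mul_sum]
        exact Finset.sum_le_sum fun i _ => h3 i
      calc FunctionSpaces.eLpNormDistrib p (FunctionSpaces.lpBlock j v)
          ≤ (1 + M₀) * (C * (2 : ℝ≥0∞) ^ (-(j : ℝ)) * (2 * M₀ * D)) :=
            h1.trans (mul_le_mul_right (h2.trans (mul_le_mul_right h4 _)) _)
        _ = ((1 + M₀) * C * (2 * M₀) * (2 : ℝ≥0∞) ^ (-(N : ℝ)) * D) *
              (2⁻¹ : ℝ≥0∞) ^ (j - N).natAbs := by
            rw [two_rpow_neg_eq_mul_half_pow hj]; ring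
    · have h0 : FunctionSpaces.lpBlock j v = 0 := by
        rw [hv]
        exact FunctionSpaces.lpBlock_sub_lowFreqCutoff_of_le (by omega) u
      rw [h0, FunctionSpaces.eLpNormDistrib_zero]
      exact bot_le
  have hreal : Tendsto (fun j => FunctionSpaces.lowFreqCutoff j v) atBot (𝓝 0) :=
    FunctionSpaces.tendsto_lowFreqCutoff_sub_lowFreqCutoff_atBot u N
  have hgeom : ∑' j : ℤ, (2⁻¹ : ℝ≥0∞) ^ (j - N).natAbs ≤ 4 := by
    refine (FunctionSpaces.tsum_int_pow_natAbs_sub_le 2⁻¹ N).trans ?_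
    rw [ENNReal.one_sub_inv_two, inv_inv]
    norm_num
  calc FunctionSpaces.eLpNormDistrib p v
      ≤ ∑' j : ℤ, FunctionSpaces.eLpNormDistrib p (FunctionSpaces.lpBlock j v) :=
        FunctionSpaces.eLpNormDistrib_le_tsum_lpBlock v hreal
    _ ≤ ∑' j : ℤ, ((1 + M₀) * C * (2 * M₀) * (2 : ℝ≥0∞) ^ (-(N : ℝ)) * D) *
          (2⁻¹ : ℝ≥0∞) ^ (j - N).natAbs := ENNReal.tsum_le_tsum hterm
    _ = ((1 + M₀) * C * (2 * M₀) * (2 : ℝ≥0∞) ^ (-(N : ℝ)) * D) *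
          ∑' j : ℤ, (2⁻¹ : ℝ≥0∞) ^ (j - N).natAbs := ENNReal.tsum_mul_left
    _ ≤ ((1 + M₀) * C * (2 * M₀) * (2 : ℝ≥0∞) ^ (-(N : ℝ)) * D) * 4 := by gcongr
    _ = (1 + M₀) * C * (2 * M₀) * 4 * (2 : ℝ≥0∞) ^ (-(N : ℝ)) * D := by ring

end Literature.Analysis.FluidPDE

end
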